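import Summits.AtomisticToContinuum.HydrodynamicLimit.Theses.InformationPercolationEngine
import HarnessLib

/-!
# Crux-strategist sketch s2 for `InformationPercolationEngine.CollisionRate` (stmt-AtomisticToContinuum-13481)

planner-cstrat-stmt-AtomisticToContinuum-13481-s2-0, 2026-08-17.  Companion of `STRATEGY-CENSUS.md` (census s2, same crux
directory): the TYPED objects the s2 census refers to, farm-checked.  Nothing here is registered as a stub (the lead's skeleton
`Lines/Sketch.lean` v29 and its stub set {`stub_marginalEnvelopeLG`, `stub_evenTubeTimeStatProbLG`} are untouched); nothing is a
route item; no statement of the route is asserted.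

* §1 STRENGTHEN S7 of the census — `PointwiseCollisionRate`: the crux with the absolute value INSIDE the space–time window
  integral (tent window `bt` in time × hat window `bx` in space, both of width `r`), i.e. the `G ≡ 1`, `h = g(σ³ρ)` instance of the
  dock's typed input `PointwiseEnskogCollisions` (`Cruxes/ChaosClosesEuler/Lines/Sketch.lean` v11 §1b).  It is the FORMAT the only
  consumer of the crux (the kinetic dock `ChaosClosesEuler`, stmt-15141, lead c4 `NOTES.md` §F (R1)/(R2), F4) can use: a fixed-`χ`
  (weak) statement such as the filed crux pins only mesoscopic Young-measure averages of the window defect.  And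
  `PointwiseCollisionRatePreShock`: the same tied to the conjunct's hypotheses (`τ < T`; the frame of recommendation R1 / lead c10's
  `PromotedT34pPreShockItem.CollisionRatePreShock`).  `pointwiseCollisionRatePreShock_of_pointwise` (PROVED): the tied form is a
  weakening of the untied one.
* §2 TRANSFER T8 of the census — the conservation-law / entropy-balance transfer made checkable: along a particle path of the
  "free-rate Euler system" (exact mass, momentum and energy balance with the collisional pressure carrying a FREE contact value `Λ`
  in place of Enskog's `F′(σ³ρ)`), the hard-sphere thermodynamic entropy `s = 3/2 log θ − log ρ − F(σ³ρ)` changes at rate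
  `σ³ρ (F′(σ³ρ) − Λ) · div u` (`freeRate_entropy_hasDerivAt`, PROVED).  So every balance law together pins the rate only through
  the sign information of a second law and is silent wherever `div u = 0` (census §Transfer T8, §Negation N7).
-/

noncomputable section

open scoped BigOperators Topology Classical MeasureTheory ENNReal InnerProductSpace
open Filter Set MeasureTheory
open Literature.MathematicalPhysics.KineticTheory
open Literature.Analysis.FluidPDE
open Summit.AtomisticToContinuum.HydrodynamicLimit.Theses.InformationPercolationEngine

namespace Summit.AtomisticToContinuum.HydrodynamicLimit.Cruxes.CollisionRate.StrategistS2

/-! ## §1 Strengthen S7 — the pointwise (window-`L¹`) form of the crux -/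

/-- **S7 · `PointwiseCollisionRate`** — the Enskog collision-frequency law WINDOW BY WINDOW: ∃ universal `η₀ > 0`; for continuous
positive local-Gibbs profiles, `σ < σ₀(profiles)`, every flow family, horizon `τ > 0`, continuous cutoff `g` vanishing on `[η₀, ∞)`,
accuracies `η, δ`: ∃ `r₀` ∀ `r < r₀` ∃ `N₀` ∀ `N ≥ N₀`, with `LG`-probability `≥ 1 − δ`,
`∫₀^τ ∫ |K_r(t₀, x₀) − R_r(t₀, x₀)| dx₀ dt₀ ≤ η`, where `K_r(t₀, x₀)` is the `(bt ⊗ bx)`-windowed normalised collision count with the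
in-band cutoff `g(σ³ρ_r(s, xᵢ))` read at the colliding particle, and `R_r(t₀, x₀) = σ³ ×` the same window of
`g(σ³ρ_r) Y(σ³ρ_r) B¹_r`, `B¹_r(s, x) = ∫∫ b_r b_r π‖v − w‖ d(μ_s ⊗ μ_s)` (SAME-TIME pair functional, as in the crux), `Y = (3/2π) f_ex′`.
Conventions (ordered contact pairs, `hsDiameter`, `Torus.geometry`, hat mollifier `3/(πr³)(1 − d/r)₊`, tent `r⁻¹(1 − |a|/r)₊`) are
VERBATIM those of `CollisionRate` (13481) and of the dock's `PointwiseEnskogCollisions` (of which this is the `G ≡ 1`,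
`h(ρ, u, θ) = g(σ³ρ)` instance).  Strictly STRONGER than the crux (`|∫∫ χ d| ≤ ‖χ‖_∞ ∫∫ |d|` plus `χ`-smearing at scale `r`);
OPEN (Boltzmann–Enskog class: it is local equilibrium of the contact pair law in most mesoscopic windows). [folklore] -/
def PointwiseCollisionRate : Prop :=
  ∃ η₀ : ℝ, 0 < η₀ ∧ ∀ (a₀ θ₀ : T3 → ℝ) (u₀ : T3 → V3), Continuous a₀ → Continuous θ₀ → Continuous u₀ →
    (∀ x, 0 < a₀ x) → (∀ x, 0 < θ₀ x) → ∃ σ₀ : ℝ, 0 < σ₀ ∧ ∀ σ : ℝ, 0 < σ → σ < σ₀ →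
    ∀ Φ : (N : ℕ) → HardSphereFlow (Torus.geometry (Fin 3)) (hsDiameter σ N) (N + 1),
    ∀ τ : ℝ, 0 < τ → ∀ g : ℝ → ℝ, Continuous g → (∀ a, η₀ ≤ a → g a = 0) →
    ∀ η δ : ℝ, 0 < η → 0 < δ → ∃ r₀ : ℝ, 0 < r₀ ∧ ∀ r : ℝ, 0 < r → r < r₀ → ∃ N₀ : ℕ, ∀ N : ℕ, N₀ ≤ N →
    let ε := hsDiameter σ N
    let Gm : Geometry (Fin 3) T3 := Torus.geometry (Fin 3)
    let γ : Config (N + 1) (Fin 3) T3 → ℝ → Config (N + 1) (Fin 3) T3 := fun z s => (Φ N).flow s z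
    let bx : T3 → T3 → ℝ := fun y x => 3 / (Real.pi * r ^ 3) * max (1 - Torus.euclidDist y x / r) 0
    let bt : ℝ → ℝ := fun a => r⁻¹ * max (1 - |a| / r) 0
    let ρm : Config (N + 1) (Fin 3) T3 → T3 → ℝ := fun w x₀ => ∫ q, bx q.1 x₀ ∂(empiricalMeasure w)
    let B1 : Config (N + 1) (Fin 3) T3 → T3 → ℝ := fun w x₀ =>
      ∫ p, bx p.1.1 x₀ * bx p.2.1 x₀ * (Real.pi * ‖p.1.2 - p.2.2‖) ∂((empiricalMeasure w).prod (empiricalMeasure w))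
    let Y : ℝ → ℝ := fun a => 3 / (2 * Real.pi) * deriv hsExcessFreeEnergy a
    let Kr : Config (N + 1) (Fin 3) T3 → ℝ → T3 → ℝ := fun z t₀ x₀ =>
      ε / (N + 1 : ℝ) * ∑ᶠ (s : ℝ) (_ : s ∈ collisionTimes Gm ε (γ z) ∩ Set.Icc 0 τ),
        ∑ i : Fin (N + 1), ∑ j : Fin (N + 1),
          (if i ≠ j ∧ ‖Gm.sepVec (γ z s i).1 (γ z s j).1‖ = ε then
            bt (s - t₀) * bx (γ z s i).1 x₀ * g (σ ^ 3 * ρm (γ z s) (γ z s i).1) else 0)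
    let R : Config (N + 1) (Fin 3) T3 → ℝ → T3 → ℝ := fun z t₀ x₀ =>
      σ ^ 3 * ∫ s in Set.Icc 0 τ, bt (s - t₀) *
        ∫ x, bx x x₀ * (g (σ ^ 3 * ρm (γ z s) x) * Y (σ ^ 3 * ρm (γ z s) x) * B1 (γ z s) x)
    localGibbsLaw σ a₀ u₀ θ₀ N (Φ N)
      {z | η < ∫ t₀ in Set.Icc 0 τ, ∫ x₀, |Kr z t₀ x₀ - R z t₀ x₀|} ≤ ENNReal.ofReal δ

/-- **S7-ps · `PointwiseCollisionRatePreShock`** — `PointwiseCollisionRate` tied to the conjunct's hypotheses: classical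
hard-sphere Euler solution `(ρ, u, θ)` on `[0, T)` with the packing guard `ρσ³ < η₀`, flow families whose local Gibbs laws satisfy the
`t = 0` law of large numbers, horizons `τ < T` (the frame of `PromotePreShock.CollisionRatePreShock`, lead c10, and of recommendation
R1 of census s1); the window functionals are VERBATIM those of `PointwiseCollisionRate`.  This is the item text census s2 recommends
(R6 + R1): pointwise, pre-shock. OPEN. [folklore] -/
def PointwiseCollisionRatePreShock : Prop :=
  ∃ η₀ : ℝ, 0 < η₀ ∧ ∀ (a₀ θ₀ : T3 → ℝ) (u₀ : T3 → V3), Continuous a₀ → Continuous θ₀ → Continuous u₀ →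
    (∀ x, 0 < a₀ x) → (∀ x, 0 < θ₀ x) → ∃ σ₀ : ℝ, 0 < σ₀ ∧ ∀ σ : ℝ, 0 < σ → σ < σ₀ →
    ∀ (T : ℝ) (ρ θ : ℝ → T3 → ℝ) (u : ℝ → T3 → V3), IsHardSphereEulerSolution σ T ρ u θ →
    (∀ t ∈ Set.Ico 0 T, ∀ x, ρ t x * σ ^ 3 < η₀) →
    ∀ Φ : (N : ℕ) → HardSphereFlow (Torus.geometry (Fin 3)) (hsDiameter σ N) (N + 1),
    TendstoHydroFieldsAt (fun N => localGibbsLaw σ a₀ u₀ θ₀ N (Φ N)) Φ ρ u θ 0 →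
    ∀ τ : ℝ, 0 < τ → τ < T → ∀ g : ℝ → ℝ, Continuous g → (∀ a, η₀ ≤ a → g a = 0) →
    ∀ η δ : ℝ, 0 < η → 0 < δ → ∃ r₀ : ℝ, 0 < r₀ ∧ ∀ r : ℝ, 0 < r → r < r₀ → ∃ N₀ : ℕ, ∀ N : ℕ, N₀ ≤ N →
    let ε := hsDiameter σ N
    let Gm : Geometry (Fin 3) T3 := Torus.geometry (Fin 3)
    let γ : Config (N + 1) (Fin 3) T3 → ℝ → Config (N + 1) (Fin 3) T3 := fun z s => (Φ N).flow s z
    let bx : T3 → T3 → ℝ := fun y x => 3 / (Real.pi * r ^ 3) * max (1 - Torus.euclidDist y x / r) 0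
    let bt : ℝ → ℝ := fun a => r⁻¹ * max (1 - |a| / r) 0
    let ρm : Config (N + 1) (Fin 3) T3 → T3 → ℝ := fun w x₀ => ∫ q, bx q.1 x₀ ∂(empiricalMeasure w)
    let B1 : Config (N + 1) (Fin 3) T3 → T3 → ℝ := fun w x₀ =>
      ∫ p, bx p.1.1 x₀ * bx p.2.1 x₀ * (Real.pi * ‖p.1.2 - p.2.2‖) ∂((empiricalMeasure w).prod (empiricalMeasure w))
    let Y : ℝ → ℝ := fun a => 3 / (2 * Real.pi) * deriv hsExcessFreeEnergy a
    let Kr : Config (N + 1) (Fin 3) T3 → ℝ → T3 → ℝ := fun z t₀ x₀ =>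
      ε / (N + 1 : ℝ) * ∑ᶠ (s : ℝ) (_ : s ∈ collisionTimes Gm ε (γ z) ∩ Set.Icc 0 τ),
        ∑ i : Fin (N + 1), ∑ j : Fin (N + 1),
          (if i ≠ j ∧ ‖Gm.sepVec (γ z s i).1 (γ z s j).1‖ = ε then
            bt (s - t₀) * bx (γ z s i).1 x₀ * g (σ ^ 3 * ρm (γ z s) (γ z s i).1) else 0)
    let R : Config (N + 1) (Fin 3) T3 → ℝ → T3 → ℝ := fun z t₀ x₀ =>
      σ ^ 3 * ∫ s in Set.Icc 0 τ, bt (s - t₀) *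
        ∫ x, bx x x₀ * (g (σ ^ 3 * ρm (γ z s) x) * Y (σ ^ 3 * ρm (γ z s) x) * B1 (γ z s) x)
    localGibbsLaw σ a₀ u₀ θ₀ N (Φ N)
      {z | η < ∫ t₀ in Set.Icc 0 τ, ∫ x₀, |Kr z t₀ x₀ - R z t₀ x₀|} ≤ ENNReal.ofReal δ

/-- The tied (pre-shock) pointwise form is a WEAKENING of the untied one: ignore the Euler solution, the guard, the `t = 0` LLN and
`τ < T`. [folklore] -/
theorem pointwiseCollisionRatePreShock_of_pointwise (h : PointwiseCollisionRate) : PointwiseCollisionRatePreShock := by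
  obtain ⟨η₀, hη₀, H⟩ := h
  refine ⟨η₀, hη₀, fun a₀ θ₀ u₀ ha hθ hu hap hθp => ?_⟩
  obtain ⟨σ₀, hσ₀, Hσ⟩ := H a₀ θ₀ u₀ ha hθ hu hap hθp
  refine ⟨σ₀, hσ₀, fun σ hσ hσ' T ρ θ u _hsol _hguard Φ _h0 τ hτ _hτT g hg hg0 η δ hη hδ => ?_⟩
  exact Hσ σ hσ hσ' Φ τ hτ g hg hg0 η δ hη hδ

/-! ## §2 Transfer T8 — entropy balance of the free-rate Euler system along a particle path -/

/-- **T8 · entropy production of the free-rate Euler system.**  Along a particle path `t ↦ (ρ t, θ t)` of a smooth solution of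
the exact balance laws in which the collisional pressure carries a FREE contact value `Λ t` — i.e. `p̃ = ρθ(1 + σ³ρ Λ)` in place of
the hard-sphere `p = ρθ(1 + σ³ρ F′(σ³ρ))` (`hsPressure`, `hsCompressibility`; `F = hsExcessFreeEnergy` on the band) — one has
`D_t ρ = −ρ · div u` (mass) and `(3/2) ρ D_t θ = −p̃ · div u` (internal energy: hard spheres are athermal, `e = 3θ/2`), hence the
thermodynamic entropy `s = 3/2 log θ − log ρ − F(σ³ρ)` obeys `D_t s = σ³ρ (F′(σ³ρ) − Λ) · div u`.  With `Λ = F′` (Enskog's rate) the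
entropy is conserved; a local second law gives only `(F′ − Λ)·div u ≥ 0` (rate ≥ Enskog in compression, ≤ in expansion); and on
`div u = 0` every balance law is silent about `Λ` (census §Transfer T8, lead c11's observation O1 made checkable).  Here `d = div u`
and `Λ` are arbitrary real functions of time; only the two ODEs are used. [folklore] -/
theorem freeRate_entropy_hasDerivAt {ρ θ d Λ F : ℝ → ℝ} {σ t F' : ℝ}
    (hρ : 0 < ρ t) (hθ : 0 < θ t)
    (hF : HasDerivAt F F' (σ ^ 3 * ρ t))
    (hρ' : HasDerivAt ρ (-(ρ t * d t)) t)
    (hθ' : HasDerivAt θ (-(2 / 3) * θ t * (1 + σ ^ 3 * ρ t * Λ t) * d t) t) :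
    HasDerivAt (fun s => 3 / 2 * Real.log (θ s) - Real.log (ρ s) - F (σ ^ 3 * ρ s))
      (σ ^ 3 * ρ t * (F' - Λ t) * d t) t := by
  have hlogθ : HasDerivAt (fun s => Real.log (θ s)) ((-(2 / 3) * θ t * (1 + σ ^ 3 * ρ t * Λ t) * d t) / θ t) t :=
    hθ'.log hθ.ne'
  have hlogρ : HasDerivAt (fun s => Real.log (ρ s)) ((-(ρ t * d t)) / ρ t) t := hρ'.log hρ.ne'
  have hinner : HasDerivAt (fun s => σ ^ 3 * ρ s) (σ ^ 3 * (-(ρ t * d t))) t := hρ'.const_mul (σ ^ 3)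
  have hF₁ : HasDerivAt F F' ((fun s => σ ^ 3 * ρ s) t) := hF
  have hcomp : HasDerivAt (fun s => F (σ ^ 3 * ρ s)) (F' * (σ ^ 3 * (-(ρ t * d t)))) t :=
    hF₁.comp t hinner
  have hsum := ((hlogθ.const_mul (3 / 2)).sub hlogρ).sub hcomp
  refine hsum.congr_deriv ?_
  have hθne : θ t ≠ 0 := hθ.ne'
  have hρne : ρ t ≠ 0 := hρ.ne'
  field_simp
  ring

end Summit.AtomisticToContinuum.HydrodynamicLimit.Cruxes.CollisionRate.StrategistS2

end
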